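import Literature.Analysis.FluidPDE.NavierStokesConcentrationCorrectorFacts
import HarnessLib

/-!
# The Cheskidov–Luo local existence fact: time shifts and the uniform grid

Analysis/FluidPDE proof file (all results proved), part of the discharge of the named fact
`Torus.CheskidovLuo2022LocalExistence` (`NavierStokesConcentrationCorrectorFacts`;
A. Cheskidov, X. Luo, *Sharp nonuniqueness for the Navier–Stokes equations*, Invent. Math. 229
(2022) = arXiv:2009.06596, §3.1 (3.2) and Prop. 3.2: on every interval `[tᵢ, tᵢ₊₁]` of a
sufficiently fine uniform grid the linearised, stress-forced system (3.2) has a smooth solution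
with `‖vᵢ‖ ≤ δ`). This file contains the two pieces of pure bookkeeping that separate the
analysis (short-time solvability on `[0, θ] × 𝕋^d`, done on the Fourier side in the
`CorrectorFourier*` files) from the printed grid statement:

* `Torus.IsLinearizedNSSolutionOn.of_timeShift` — **time translation**: a solution `(V, Q)` of
  (3.2) on `[0, θ]` for the shifted background `u(· + a)`, `R(· + a)` gives the solution
  `v(t) = V(t - a)`, `q(t) = Q(t - a)` on `[a, a + θ]` for `u`, `R` (the system is autonomous
  apart from the data; the one-sided time derivative within `[a, a + θ]` is the one within
  `[0, θ]` by the chain rule);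
* `Torus.CheskidovLuo2022LocalExistence.of_shortTime` — **the grid**: if for every `δ > 0`
  there is a threshold `θ₀ > 0` (depending on `δ` and the background on `[0, T]`) such that
  (3.2) with shifted data is solvable on `[0, θ]` with `‖v‖ ≤ δ` whenever `0 < θ ≤ θ₀` and
  `[a, a + θ] ⊆ [0, T]`, then `Torus.CheskidovLuo2022LocalExistence` holds (take
  `n₀ > T/θ₀`, `a = iT/n`, `θ = T/n`).

## References

* A. Cheskidov, X. Luo, arXiv:2009.06596, §3.1 (3.2) ("for all sufficiently small `τ > 0`, we
  may solve equation (3.2) on intervals `[tᵢ, tᵢ₊₁]`"), Prop. 3.2. [`CheskidovLuo2022`]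
-/

open MeasureTheory Set Filter
open scoped InnerProductSpace ContDiff

noncomputable section

namespace Literature.Analysis.FluidPDE

namespace Torus

variable {d : Type*} [Fintype d] [DecidableEq d]

/-! ### Time shifts -/

section Shift

omit [DecidableEq d] in
/-- **Joint smoothness is invariant under time shifts**: if `V` is jointly smooth on
`[0, θ] × 𝕋^d` then `t ↦ V(t - a)` is jointly smooth on `[a, a + θ] × 𝕋^d`. [folklore] -/
theorem isSmoothSpaceTimeOn_comp_sub {F : Type*} [NormedAddCommGroup F] [NormedSpace ℝ F]
    {V : ℝ → UnitAddTorus d → F} {a θ : ℝ}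
    (hV : FunctionSpaces.Torus.IsSmoothSpaceTimeOn (Icc 0 θ) V) :
    FunctionSpaces.Torus.IsSmoothSpaceTimeOn (Icc a (a + θ)) (fun t => V (t - a)) := by
  have hφ : ContDiff ℝ ∞ (fun z : ℝ × EuclideanSpace ℝ d => ((z.1 - a, z.2) : ℝ × EuclideanSpace ℝ d)) :=
    (contDiff_fst.sub contDiff_const).prodMk contDiff_snd
  have hmaps : MapsTo (fun z : ℝ × EuclideanSpace ℝ d => ((z.1 - a, z.2) : ℝ × EuclideanSpace ℝ d))
      (Icc a (a + θ) ×ˢ univ) (Icc 0 θ ×ˢ univ) := fun z hz =>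
    mk_mem_prod ⟨by linarith [hz.1.1], by linarith [hz.1.2]⟩ (mem_univ _)
  exact hV.comp hφ.contDiffOn hmaps

omit [DecidableEq d] in
/-- **Chain rule for the one-sided time derivative under a time shift**:
`∂ₜ (V(· - a)) = (∂ₜV)(t - a)`, the left side within `[a, a + θ]`, the right side within
`[0, θ]`. [folklore] -/
theorem timeDerivWithin_comp_sub {F : Type*} [NormedAddCommGroup F] [NormedSpace ℝ F]
    {V : ℝ → UnitAddTorus d → F} {a θ : ℝ} (hθ : 0 < θ)
    (hV : FunctionSpaces.Torus.IsSmoothSpaceTimeOn (Icc 0 θ) V)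
    {t : ℝ} (ht : t ∈ Icc a (a + θ)) (x : UnitAddTorus d) :
    FunctionSpaces.Torus.timeDerivWithin (Icc a (a + θ)) (fun s => V (s - a)) t x =
      FunctionSpaces.Torus.timeDerivWithin (Icc 0 θ) V (t - a) x := by
  have hs : t - a ∈ Icc 0 θ := ⟨by linarith [ht.1], by linarith [ht.2]⟩
  have hg : HasDerivWithinAt (fun τ => V τ x) (FunctionSpaces.Torus.timeDerivWithin (Icc 0 θ) V (t - a) x)
      (Icc 0 θ) (t - a) :=
    hV.hasDerivWithinAt_slice hs x
  have hh : HasDerivWithinAt (fun s : ℝ => s - a) 1 (Icc a (a + θ)) t :=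
    ((hasDerivAt_id t).sub_const a).hasDerivWithinAt
  have hmaps : MapsTo (fun s : ℝ => s - a) (Icc a (a + θ)) (Icc 0 θ) := fun s hs' =>
    ⟨by linarith [hs'.1], by linarith [hs'.2]⟩
  have hcomp := hg.scomp t hh hmaps
  rw [one_smul] at hcomp
  have hab : a < a + θ := by linarith
  exact hcomp.derivWithin (uniqueDiffOn_Icc hab t ht)

/-- **Time translation of solutions of (3.2).** A solution `(V, Q)` on `[0, θ] × 𝕋^d` of the
linearised, stress-forced system (3.2) for the shifted background `u(· + a)`, `R(· + a)` yields
the solution `v(t) = V(t - a)`, `q(t) = Q(t - a)` on `[a, a + θ]` for `u`, `R` (the system is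
autonomous apart from its data). [cite: CheskidovLuo2022, §3.1 (3.2)] -/
theorem IsLinearizedNSSolutionOn.of_timeShift {u : ℝ → UnitAddTorus d → EuclideanSpace ℝ d}
    {R : ℝ → UnitAddTorus d → d → EuclideanSpace ℝ d} {a θ : ℝ} (hθ : 0 < θ)
    {V : ℝ → UnitAddTorus d → EuclideanSpace ℝ d} {Q : ℝ → UnitAddTorus d → ℝ}
    (h : IsLinearizedNSSolutionOn (fun t => u (t + a)) (fun t => R (t + a)) 0 θ V Q) :
    IsLinearizedNSSolutionOn u R a (a + θ) (fun t => V (t - a)) (fun t => Q (t - a)) where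
  smooth_v := isSmoothSpaceTimeOn_comp_sub h.smooth_v
  smooth_q := isSmoothSpaceTimeOn_comp_sub h.smooth_q
  momentum t ht x := by
    have hs : t - a ∈ Icc 0 θ := ⟨by linarith [ht.1], by linarith [ht.2]⟩
    have hm := h.momentum (t - a) hs x
    simp only [sub_add_cancel] at hm
    rw [timeDerivWithin_comp_sub hθ h.smooth_v ht x]
    exact hm
  divFree t ht := h.divFree (t - a) ⟨by linarith [ht.1], by linarith [ht.2]⟩
  initial x := by simpa using h.initial x
  hasZeroMean_v t ht := h.hasZeroMean_v (t - a) ⟨by linarith [ht.1], by linarith [ht.2]⟩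
  hasZeroMean_q t ht := h.hasZeroMean_q (t - a) ⟨by linarith [ht.1], by linarith [ht.2]⟩

end Shift

/-! ### The grid -/

section Grid

/-- **From short-time solvability to the printed grid statement.** Suppose that for every
smooth solution `(u, P, R)` of the Navier–Stokes–Reynolds system on `[0, T] × 𝕋^d` (`d ≥ 2`,
viscosity `1`) and every `δ > 0` there is `θ₀ > 0` such that, whenever `0 < θ ≤ θ₀` and
`[a, a + θ] ⊆ [0, T]`, the system (3.2) for the shifted background `u(· + a)`, `R(· + a)` has a
smooth solution `(V, Q)` on `[0, θ]` with `‖V(t, x)‖ ≤ δ`. Then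
`Torus.CheskidovLuo2022LocalExistence` holds: for `n ≥ n₀ > T/θ₀` every grid interval
`[iT/n, (i+1)T/n]`, `i < n`, has length `T/n ≤ θ₀` and lies in `[0, T]`, and the shifted
solution is translated back by `IsLinearizedNSSolutionOn.of_timeShift` (CL22, §3.1: "for all
sufficiently small `τ > 0`, we may solve equation (3.2) on intervals `[tᵢ, tᵢ₊₁]`";
`tᵢ = iτ^ε`). [cite: CheskidovLuo2022, §3.1 (3.2) and Prop. 3.2] -/
theorem CheskidovLuo2022LocalExistence.of_shortTime
    (H : 2 ≤ Fintype.card d → ∀ (T : ℝ), 0 < T →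
      ∀ (u : ℝ → UnitAddTorus d → EuclideanSpace ℝ d) (P : ℝ → UnitAddTorus d → ℝ)
        (R : ℝ → UnitAddTorus d → d → EuclideanSpace ℝ d), IsNSReynoldsOn (Icc 0 T) 1 u P R →
      ∀ (δ : ℝ), 0 < δ → ∃ θ₀ : ℝ, 0 < θ₀ ∧ ∀ (a θ : ℝ), 0 ≤ a → 0 < θ → θ ≤ θ₀ → a + θ ≤ T →
        ∃ (V : ℝ → UnitAddTorus d → EuclideanSpace ℝ d) (Q : ℝ → UnitAddTorus d → ℝ),
          IsLinearizedNSSolutionOn (fun t => u (t + a)) (fun t => R (t + a)) 0 θ V Q ∧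
            ∀ t ∈ Icc 0 θ, ∀ x, ‖V t x‖ ≤ δ) :
    CheskidovLuo2022LocalExistence (d := d) := by
  intro hd T hT u P R hNSR δ hδ
  obtain ⟨θ₀, hθ₀, Hloc⟩ := H hd T hT u P R hNSR δ hδ
  -- the grid threshold: `n₀ > T / θ₀`
  obtain ⟨n₀, hn₀⟩ := exists_nat_gt (T / θ₀)
  have hn₀pos : 0 < n₀ := by
    have : (0 : ℝ) < n₀ := lt_of_le_of_lt (div_nonneg hT.le hθ₀.le) hn₀
    exact_mod_cast this
  refine ⟨n₀, hn₀pos, fun n hn i hi => ?_⟩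
  have hn_pos : (0 : ℝ) < n := by exact_mod_cast hn₀pos.trans_le hn
  have hθ : 0 < T / n := div_pos hT hn_pos
  have hθle : T / n ≤ θ₀ := by
    have h1 : T / θ₀ < n := hn₀.trans_le (by exact_mod_cast hn)
    rw [div_le_iff₀ hn_pos]
    rw [div_lt_iff₀ hθ₀] at h1
    linarith
  set a : ℝ := i * (T / n) with ha_def
  have ha0 : 0 ≤ a := by rw [ha_def]; positivity
  have haT : a + T / n ≤ T := by
    have hi1 : (i : ℝ) + 1 ≤ n := by exact_mod_cast Nat.succ_le_of_lt hi
    calc a + T / n = (i + 1) * (T / n) := by rw [ha_def]; ring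
      _ ≤ n * (T / n) := mul_le_mul_of_nonneg_right hi1 hθ.le
      _ = T := mul_div_cancel₀ T hn_pos.ne'
  obtain ⟨V, Q, hsol, hbound⟩ := Hloc a (T / n) ha0 hθ hθle haT
  have hshift := IsLinearizedNSSolutionOn.of_timeShift hθ hsol
  have hend : a + T / n = (i + 1) * (T / n) := by rw [ha_def]; ring
  rw [hend] at hshift
  refine ⟨fun t => V (t - a), fun t => Q (t - a), hshift, fun t ht x => ?_⟩
  rw [← hend] at ht
  exact hbound (t - a) ⟨by linarith [ht.1], by linarith [ht.2]⟩ x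

end Grid

end Torus

end Literature.Analysis.FluidPDE

end
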